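import Mathlib
import Summits.Ventures.PercRepro2.TypedContract
import Summits.Ventures.PercRepro2.TypedResidualBase
import Summits.Ventures.PercRepro2.TypedPendantRootSeriesCone

/-!
# The class-`1` chain of length two: the mark-like corner through a class-`2` series edge
(blind cell PercRepro2, mine-2 g51, 2026-08-29; `conjectures/MINE-2.md` M2-108 add. 2)

The series-chain rule for the equality locus of (PM-ROOT) (M2-108) says: follow the chain of
series edges from the root's attachment vertex; the first class-`1` edge puts the instance on the
mark-like corner `N₁ = N₃`, `N₂ = 2·N₃`.  `TypedPendantRootSeriesCone.lean` proves the length-one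
case.  Here the length-two case: the root `a₁` hangs at `u` by `f`, `u` carries the single further
typed edge `e = {u, v}` of class `2`, and `v` (unmarked) carries the single further typed edge
`e' = {v, v'}` of class `1`.  Then **`pendant_root_chain_two_one_corner`**: `N₁ = N₃` and
`N₂ = 2·N₃` — by `pendant_root_series_two` at `u`, the contraction of the pinned-open `e`
(`typedCount_contract_open`, the contracted `e` a pinned loop re-pinned closed by
`typedCount_pinned_loop`), and the length-one corner at the merged vertex.  The same three steps
iterate along any chain of class-`2` series edges.  Own work; standard axioms.
-/

namespace Summit.Ventures.PercRepro2

open CovForm CovForm.OneTyped CovForm.TypedRed Contract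

namespace CovForm

namespace TypedRed

section Chain

open Classical

variable {V : Type*} {E : Type*} [DecidableEq V] [Fintype E] [DecidableEq E] {R : Type*} [Field R]
  [LinearOrder R] [IsStrictOrderedRing R]
variable (ends : E → Sym2 V) (o a₁ a₂ a₃ b : V)

/-- **The corner through a class-`2` series edge followed by a class-`1` series edge**:
`a₁ — u — v — v'` with `e = {u, v}` of class `2` and `e' = {v, v'}` of class `1`, `u` and `v`
unmarked with no other open edge: `N₁ = N₃` and `N₂ = 2·N₃`. -/
theorem pendant_root_chain_two_one_corner {f e e' : E} (hef : e ≠ f) (he'f : e' ≠ f)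
    (he'e : e' ≠ e) {u v v' : V} (hf : ends f = s(a₁, u)) (hleaf : ∀ g, a₁ ∈ ends g → g = f)
    (he : ends e = s(u, v)) (he' : ends e' = s(v, v')) (hu1 : u ≠ a₁) (huv : u ≠ v)
    (huo : u ≠ o) (hu2 : u ≠ a₂) (hu3 : u ≠ a₃) (hub : u ≠ b) (hv1 : v ≠ a₁) (hvv' : v ≠ v')
    (huv' : u ≠ v') (hvo : v ≠ o) (hv2 : v ≠ a₂) (hv3 : v ≠ a₃) (hvb : v ≠ b) (F : Finset E)
    (hfF : f ∈ F) (heF : e ∈ F) (he'F : e' ∈ F) (z : Config E) (τ : E → ℕ)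
    (hτ : ∀ g ∈ F, τ g = 1 ∨ τ g = 2) (hτe : τ e = 2) (hτe' : τ e' = 1)
    (hclu : ∀ g, g ≠ f → g ≠ e → u ∈ ends g → g ∉ F ∧ z g = false)
    (hclv : ∀ g, g ≠ e → g ≠ e' → v ∈ ends g → g ∉ F ∧ z g = false) :
    typedCount F z (Function.update τ f 1)
          (K3 ends o a₁ a₂ a₃ b : Config E → Config E → Config E → R) =
        typedCount F z (Function.update τ f 3) (K3 ends o a₁ a₂ a₃ b) ∧
      typedCount F z (Function.update τ f 2)
          (K3 ends o a₁ a₂ a₃ b : Config E → Config E → Config E → R) =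
        2 * typedCount F z (Function.update τ f 3) (K3 ends o a₁ a₂ a₃ b) := by
  -- step 1: the series rule at `u`
  obtain ⟨h1, h2, h3⟩ := pendant_root_series_two (R := R) ends o a₁ a₂ a₃ b hef hf hleaf he hu1 huv
    huo hu2 hu3 hub F hfF heF z τ hτ hτe hclu
  -- step 2: contract the pinned-open `e` and close the loop it becomes
  set W : Finset V := {u, v} with hW
  have hmem : ∀ x : V, x ∈ W ↔ x = u ∨ x = v := fun x => by
    rw [hW, Finset.mem_insert, Finset.mem_singleton]
  have cmu : contractMap W u u = u := contractMap_of_mem ((hmem u).2 (Or.inl rfl))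
  have cmv : contractMap W u v = u := contractMap_of_mem ((hmem v).2 (Or.inr rfl))
  have cmfix : ∀ x : V, x ≠ u → x ≠ v → contractMap W u x = x := fun x h1 h2 =>
    contractMap_of_notMem (fun h => by rcases (hmem x).1 h with h | h <;> contradiction)
  have cmo := cmfix o huo.symm hvo.symm
  have cm1 := cmfix a₁ hu1.symm hv1.symm
  have cm2 := cmfix a₂ hu2.symm hv2.symm
  have cm3 := cmfix a₃ hu3.symm hv3.symm
  have cmb := cmfix b hub.symm hvb.symm
  have cmv' := cmfix v' huv'.symm hvv'.symm
  have heF' : e ∉ F.erase e := fun h => (Finset.mem_erase.1 h).1 rfl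
  have hze : Function.update z e true e = true := Function.update_self e true z
  have hloop : contractEnds ends W u e = s(u, u) := by
    rw [contractEnds_apply, he, Sym2.map_mk, cmu, cmv]
  set ends' := contractEnds ends W u with hends'
  have step : ∀ k : ℕ, typedCount (F.erase e) (Function.update z e true) (Function.update τ f k)
      (K3 ends o a₁ a₂ a₃ b : Config E → Config E → Config E → R) =
      typedCount (F.erase e) (Function.update z e false) (Function.update τ f k)
        (K3 ends' o a₁ a₂ a₃ b) := by
    intro k
    rw [typedCount_contract_open ends o a₁ a₂ a₃ b he (F.erase e) heF' _ hze, cmo, cm1, cm2, cm3, cmb,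
      ← hends', typedCount_pinned_loop ends' o a₁ a₂ a₃ b hloop (F.erase e) heF' _ hze,
      Function.update_idem]
  rw [step 1] at h1
  rw [step 2, step 1] at h2
  rw [step 2] at h3
  -- step 3: the length-one corner at the merged vertex, in the contracted graph
  have hf' : ends' f = s(a₁, u) := by rw [hends', contractEnds_apply, hf, Sym2.map_mk, cm1, cmu]
  have he'' : ends' e' = s(u, v') := by
    rw [hends', contractEnds_apply, he', Sym2.map_mk, cmv, cmv']
  have hleaf' : ∀ g, a₁ ∈ ends' g → g = f := by
    intro g hg
    rw [hends', contractEnds_apply, Sym2.mem_map] at hg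
    obtain ⟨x, hx, hxa⟩ := hg
    by_cases hxW : x ∈ W
    · rw [contractMap_of_mem hxW] at hxa; exact absurd hxa hu1
    · rw [contractMap_of_notMem hxW] at hxa; subst hxa; exact hleaf g hx
  have hcl' : ∀ g, g ≠ f → g ≠ e' → u ∈ ends' g → g ∉ F.erase e ∧ Function.update z e false g = false := by
    intro g hgf hge' hg
    by_cases hge : g = e
    · rw [hge]; exact ⟨heF', Function.update_self e false z⟩
    · rw [hends', contractEnds_apply, Sym2.mem_map] at hg
      obtain ⟨x, hx, hxu⟩ := hg
      have hxW : x ∈ W := by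
        by_contra hxW
        rw [contractMap_of_notMem hxW] at hxu
        exact hxW ((hmem x).2 (Or.inl hxu))
      rcases (hmem x).1 hxW with rfl | rfl
      · obtain ⟨hF, hz⟩ := hclu g hgf hge hx
        exact ⟨fun h => hF (Finset.mem_of_mem_erase h), by rw [Function.update_of_ne hge]; exact hz⟩
      · obtain ⟨hF, hz⟩ := hclv g hge hge' hx
        exact ⟨fun h => hF (Finset.mem_of_mem_erase h), by rw [Function.update_of_ne hge]; exact hz⟩
  obtain ⟨c1, c2⟩ := pendant_root_series_one_corner (R := R) ends' o a₁ a₂ a₃ b he'f hf' hleaf' he''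
    hu1 huv' huo hu2 hu3 hub (F.erase e) (Finset.mem_erase.2 ⟨hef.symm, hfF⟩)
    (Finset.mem_erase.2 ⟨he'e, he'F⟩) (Function.update z e false) τ
    (fun g hg => hτ g (Finset.mem_of_mem_erase hg)) hτe' hcl'
  rw [h1, h2, h3, c1, c2]
  constructor <;> ring

end Chain

end TypedRed

end CovForm

end Summit.Ventures.PercRepro2
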